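import Summits.HodgeConjecture.HodgeConjecture.Theorems.K2E3CayleySliceConjugatesNhdsNonsplit   -- ★ p855570 (this seat): U12-d₂ at non-split places
import Summits.HodgeConjecture.HodgeConjecture.Theorems.K2E3CayleySliceConjugatesNhdsSplit      -- ★ p855631 (this seat): U12-d₂ at split places
import HarnessLib

/-!
# K2 · E3 ∕ U12-d — PAYER of sub-socket U12-d₂ `sig_K2E3CayleySliceConjugatesNhds`: conjugates of the Cayley slice through a semisimple point fill a neighbourhood
# (Harish-Chandra's submersion `(x, m) ↦ x s m x⁻¹`, `U_N(H)(L⁺_v)`, general `N`, EVERY finite place `v`)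

HCML Track B «K2-LIT», cell `pub/hodgecm-mathlib`, crux H413 = `stmt-HodgeConjecture-24833` (`--supports … --as helper`), seat `hodgecm-mathlib-K2E3-p12` (g0), line lead of
row 12.  **`cayleySliceConjugatesNhds`** has, token for token, the statement of the socket
`Summit.HodgeConjecture.HodgeConjecture.Cruxes.H413.K2E3EllipticInputs.U12Characters.sig_K2E3CayleySliceConjugatesNhds` (`Cruxes/H413/Lines/K2_E3_EllipticInputsSigs_U12Characters.lean`
ED. 3, commit afcbd7452724 :224 — itself the bytes of this seat's `SUBSIGS-U12d-CayleySlice.v1` 8fea84bcf8bff209), so the dealer's next edition re-ties the socket BY NAME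
(`:= K2E3CayleySliceConjugatesNhds.cayleySliceConjugatesNhds`; HOME tie probe `K2/K2E3-p12/g0/ProbeTie_U12d2.K2E3-p12-g0.lean`).  Proof: a place `w ∣ v` exists
(★ `instNonemptyPlacesOver`); if `c•w = w` (non-split `v`) ★ `cayleySliceConjugatesNhds_of_nonsplit` (one-place model `U(σ_w, H_w)(L_w)`), else ★ `cayleySliceConjugatesNhds_of_split`
(`GL_N(L_w)` model).  With U12-d₂ ★ the socket U12-d `sig_K2E3NormalizedCharBddNearSemisimple` (HC1999 Thm 16.3(2), local form) is closed RELATIVE to the single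
analytic input U12-d₁ `sig_K2E3NormalizedCharBddOnCayleySlice` (HC1999 Thm 16.2 + Cor 6.2 on the slice).  [HarishChandra1999 §18 p. 79]
THEOREMS ONLY; no `sorry`; axioms ⊆ the trio.  HONEST LABEL: HC_CM is proved only modulo the 7 printed citations (2 remaining named inputs: hLiu418 =
stmt-HodgeConjecture-24832, h413 = stmt-HodgeConjecture-24833) until rung 0 closes.

## References
* [HarishChandra1999AdmissibleDistributions] Harish-Chandra (DeBacker–Sally), *Admissible Invariant Distributions on Reductive p-adic Groups* (1999), §18 p. 79.
* [HarishChandra1970] Harish-Chandra (van Dijk), *Harmonic Analysis on Reductive p-adic Groups*, LNM 162 (1970), p. 56.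
* [PlatonovRapinchuk1994] V. Platonov, A. Rapinchuk, *Algebraic Groups and Number Theory* (1994), §5.1 (local models of unitary groups).
-/

set_option autoImplicit false
set_option linter.dupNamespace false

noncomputable section

open Filter Topology Set NumberField IsDedekindDomain
open scoped Matrix MatrixGroups
open Literature.NumberTheory.Automorphic Literature.NumberTheory.Automorphic.UnitaryGroup
open Summit.HodgeConjecture.HodgeConjecture.Cruxes.H413.K2E3CayleySliceConjugatesNhdsNonsplit
open Summit.HodgeConjecture.HodgeConjecture.Cruxes.H413.K2E3CayleySliceConjugatesNhdsSplit

namespace Summit.HodgeConjecture.HodgeConjecture.Cruxes.H413.K2E3CayleySliceConjugatesNhds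

/-- **U12-d₂ PAID: conjugates of the Cayley slice through a semisimple point fill a neighbourhood.**  For `L` CM, `H` hermitian with `det H ≠ 0`, a finite place
`v` of `L⁺`, `s ∈ U_N(H)(L⁺_v)` with semisimple matrix and any neighbourhood `V` of `0` in `M_N(L ⊗ L⁺_v)`: there is an open `U ∋ s` such that every `g ∈ U` is
`U_N(H)(L⁺_v)`-conjugate to `s·(1+Y)(1−Y)⁻¹` with `Y ∈ V`, `(σY)ᵀJ_v = −J_vY`, `MAT(s)Y = Y MAT(s)`, `1 ± Y` units.  Statement = socket
`…U12Characters.sig_K2E3CayleySliceConjugatesNhds` VERBATIM; proof = ★ non-split ∨ ★ split at a place `w ∣ v`.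
[cite: HarishChandra1999AdmissibleDistributions, §18 p. 79] [cite: HarishChandra1970, p. 56] [cite: PlatonovRapinchuk1994, §5.1] -/
theorem cayleySliceConjugatesNhds :
  ∀ (L : Type) [Field L] [NumberField L] [IsCMField L] (N : ℕ) (H : Matrix (Fin N) (Fin N) L),
    (H.map (cmConjRingHom L))ᵀ = H → H.det ≠ 0 →
    ∀ (v : HeightOneSpectrum (𝓞 ↥(maximalRealSubfield L)))
      (s : (UnitaryGroup.cmDatum L N H).Local v), Module.End.IsSemisimple (Matrix.toLin' ((s.val : GL (Fin N) (UnitaryGroup.LocalRing L v)).val : Matrix (Fin N) (Fin N) (UnitaryGroup.LocalRing L v))) →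
    ∀ V : Set (Matrix (Fin N) (Fin N) (UnitaryGroup.LocalRing L v)), V ∈ 𝓝 (0 : Matrix (Fin N) (Fin N) (UnitaryGroup.LocalRing L v)) →
      ∃ U : Set ((UnitaryGroup.cmDatum L N H).Local v), IsOpen U ∧ s ∈ U ∧
        ∀ g ∈ U, ∃ x : (UnitaryGroup.cmDatum L N H).Local v,
          ∃ Y ∈ V, (Y.map (UnitaryGroup.conjLocal L (IsCMField.complexConj L) v))ᵀ * ((UnitaryGroup.adelicForm L N H).map (UnitaryGroup.adeleToLocal L v)) = -(((UnitaryGroup.adelicForm L N H).map (UnitaryGroup.adeleToLocal L v)) * Y) ∧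
          ((s.val : GL (Fin N) (UnitaryGroup.LocalRing L v)) : Matrix (Fin N) (Fin N) (UnitaryGroup.LocalRing L v)) * Y = Y * ((s.val : GL (Fin N) (UnitaryGroup.LocalRing L v)) : Matrix (Fin N) (Fin N) (UnitaryGroup.LocalRing L v)) ∧
          IsUnit (1 - Y) ∧ IsUnit (1 + Y) ∧
          (((x * g * x⁻¹).val : GL (Fin N) (UnitaryGroup.LocalRing L v)) : Matrix (Fin N) (Fin N) (UnitaryGroup.LocalRing L v)) = ((s.val : GL (Fin N) (UnitaryGroup.LocalRing L v)) : Matrix (Fin N) (Fin N) (UnitaryGroup.LocalRing L v)) * ((1 + Y) * (1 - Y)⁻¹) := by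
  intro L _ _ _ N H hH hHd v s hs V hV
  obtain ⟨w⟩ : Nonempty (UnitaryGroup.PlacesOver L v) := inferInstance
  by_cases hw : IsCMField.complexConj L • w.1 = w.1
  · exact cayleySliceConjugatesNhds_of_nonsplit L N H v hHd w hw s hs V hV
  · exact cayleySliceConjugatesNhds_of_split L N H v hH hHd w hw s hs V hV

end Summit.HodgeConjecture.HodgeConjecture.Cruxes.H413.K2E3CayleySliceConjugatesNhds

end
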